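import Summits.BirchSwinnertonDyer.BirchSwinnertonDyer.Theorems.PrintCf2SplitBadTwoFirstLayerInertAtSeven
import HarnessLib

/-!
# Crux `PrintCf2.SplitBadTwoRankOneOfFacts` (stmt-BirchSwinnertonDyer-20368), road α v10.3 — S3c assembly, residual (R-KER) DISCHARGED:
# the kernel class function is `e_k ≡ 0`

Cell `bsd-print-cf2`, width seat `bsd-line-cf2-p1-w6` g2 (prover-bsd-line-cf2-p1-w6-g2-0); `--supports stmt-BirchSwinnertonDyer-20368`
(helper, Theses-free). HONEST FRAMING: nothing here closes the crux or a registered stub; BSD is not proved by any of this; no summit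
statement is proved by this seat. No definition, no named fact, no `sorry`.

WHAT. LEAD g12's fourth cut `restrictedControl_two_of_residuals_split_places` (`…RestrictedControlOfResidualsSplitPlaces`, 20:40Z) proves the
registered S3c statement from displayed residuals; its residual **(R-KER)** reads «there is a class function `ek : ℤ → ℤ → ℤ` of `[d]₂` with
`v₂ #ker(𝔖_{v̄}(K, W*) → 𝔖_{v̄}(K*_∞, W*)) = ek(d mod 2, …)` on every frame». By file 4 (`natCard_ker_control_of_frame_eq_one_unconditional`:
`#ker = 1`, `v₂ #ker = 0` on EVERY frame, no hypothesis) this holds with **`ek ≡ 0`**: `kerResidual_holds` states (R-KER) VERBATIM (same binders,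
same order, including the idle pinning clause and `γ′`) and proves it. The LEAD feeds it by name; `e_C`'s kernel summand is `0`.
[cite: Agboola2007, §3 Prop. 3.2] [cite: GreenbergLNM1716, §3 Lemma 3.1]
-/

noncomputable section

open scoped Classical

set_option linter.dupNamespace false
set_option autoImplicit false

open NumberField IsDedekindDomain Field WeierstrassCurve
open Literature.NumberTheory.EllipticCurves Literature.NumberTheory.EllipticCurves.GreenbergSelmer
open Literature.NumberTheory.EllipticCurves.Agboola2007
open Literature.NumberTheory.EllipticCurves.IwasawaDual
open Literature.NumberTheory.GaloisRepresentations

namespace Summit.BirchSwinnertonDyer.BirchSwinnertonDyer.Theorems.PrintCf2.RestrictedSelmerPair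

/-- **(R-KER) HOLDS WITH `ek ≡ 0`.** The residual hypothesis `hKer` of LEAD g12's `restrictedControl_two_of_residuals_split_places`, verbatim:
a class function `ek` of the `2`-adic class of `d` computing `v₂ #ker` of the bottom control map on every S3c₂ frame — provided by the zero
function, since the kernel is trivial on every frame (`natCard_ker_control_of_frame_eq_one_unconditional`, via (H7) at the place above `7`).
[cite: Agboola2007, §3 Prop. 3.2 (arXiv p0008:L128–135, L197)] [cite: GreenbergLNM1716, §3 Lemma 3.1] -/
theorem kerResidual_holds :
    ∃ ek : ℤ → ℤ → ℤ, ∀ (d : ℤ), d ≠ 0 → Squarefree d → d % 4 ≠ 1 →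
      ∀ (W : WeierstrassCurve ℚ) [W.IsElliptic] (C : VariableChange ℚ), C • W = cm7.quadraticTwist (d : ℚ) →
      ∀ (K : Type) [Field K] [NumberField K], IsImaginaryQuadratic K →
      ∀ (v vbar : HeightOneSpectrum (𝓞 K)),
        ((2 : ℕ) : 𝓞 K) ∈ v.asIdeal → ((2 : ℕ) : 𝓞 K) ∈ vbar.asIdeal → vbar ≠ v →
      ∀ (π : (W.baseChange K).endRing), (π : AddMonoid.End (W.baseChange K).geomPoints) * π = π - 2 →
      ∀ (r : ℤ_[2]), r * r = r - 2 →
        (∀ τ ∈ GreenbergSelmer.inertia v, ∀ x : ↥((W.baseChange K).endEigenPrimaryTorsion 2 π r), τ • x = x ∨ τ • x = -x) →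
      ∀ (κ' : ZpExtension K 2), κ'.IsUnramifiedOutside vbar → ∀ (γ' : absoluteGaloisGroup K), κ'.IsTopGenerator γ' →
        (padicValNat 2 (Nat.card ↥(restrictedSelmerBase ↥((W.baseChange K).endEigenPrimaryTorsion 2 π r) 2 vbar ⊓
          (resOfLe ↥((W.baseChange K).endEigenPrimaryTorsion 2 π r) (le_top : κ'.kerSubgroup ≤ ⊤)).ker)) : ℤ) =
          ek (d % 2) ((d / (2 - d % 2)) % 8) := by
  refine ⟨fun _ _ ↦ 0, ?_⟩
  intro d hd0 _ _ W _ C hC K _ _ hK v vbar hv hvbar hne π hrel r hr _ κ' hκ' _ _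
  rw [(natCard_ker_control_of_frame_eq_one_unconditional hd0 W C hC hK v vbar hv hvbar hne π hrel hr κ' hκ').2]
  rfl

/-- **`v₂ #ker = 0` as an integer**, the form in which (R-KER) enters the class-function bookkeeping `e_C = e_K + e_{v̄} − e_k − e_Γ`:
`e_k = 0` on every frame. [cite: Agboola2007, §3 Prop. 3.2] -/
theorem padicValNat_ker_control_of_frame_eq_zero {K : Type} [Field K] [NumberField K] {d : ℤ} (hd0 : d ≠ 0)
    (W : WeierstrassCurve ℚ) [W.IsElliptic] (C : VariableChange ℚ) (hC : C • W = cm7.quadraticTwist (d : ℚ)) (hK : IsImaginaryQuadratic K)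
    (v vbar : HeightOneSpectrum (𝓞 K)) (hv : ((2 : ℕ) : 𝓞 K) ∈ v.asIdeal) (hvbar : ((2 : ℕ) : 𝓞 K) ∈ vbar.asIdeal)
    (hne : vbar ≠ v) (π : (W.baseChange K).endRing) (hrel : (π : AddMonoid.End (W.baseChange K).geomPoints) * π = π - 2)
    {r : ℤ_[2]} (hr : r * r = r - 2) (κ' : ZpExtension K 2) (hκ' : κ'.IsUnramifiedOutside vbar) :
    (padicValNat 2 (Nat.card ↥(restrictedSelmerBase ↥((W.baseChange K).endEigenPrimaryTorsion 2 π r) 2 vbar ⊓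
      (resOfLe ↥((W.baseChange K).endEigenPrimaryTorsion 2 π r) (le_top : κ'.kerSubgroup ≤ ⊤)).ker)) : ℤ) = 0 := by
  rw [(natCard_ker_control_of_frame_eq_one_unconditional hd0 W C hC hK v vbar hv hvbar hne π hrel hr κ' hκ').2]
  rfl

end Summit.BirchSwinnertonDyer.BirchSwinnertonDyer.Theorems.PrintCf2.RestrictedSelmerPair

end
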